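import Summits.QuantumFields.YangMills.Theorems.FluctuationComparisonRegPrIntLHistoryPartitionDefs
import Summits.QuantumFields.YangMills.Theorems.FluctuationComparisonRegPrIntLRestrictedDensityAdditivity
import HarnessLib

/-!
# Route `UnitScaleTilt` — crux `FluctuationComparisonRegPrIntL` (stmt-QuantumFields-20520): THE HISTORY PARTITION — FINITE ADDITIVITY OF THE HEIGHT DENSITY
# OVER HISTORIES, THE PLAQUETTE-ENTROPY COUNT `historyCount` (small factors `e^{−κp(g_i)²}` of (67)–(71) beat the plaquette count `24·L^{3(m+i)}`, K-UNIFORMLY),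
# AND THE CUT-OFF-HEIGHT RUNG of the per-history large-field bound (support proofs; companion of `…HistoryPartitionDefs`)

TYPED by ideator `ym-r3-idea-1` g23 (`pub/ideators/ym-r3-idea-1/g23/FluctuationComparisonRegPrIntLHistoryPartition.lean` sha16 a0972f2ab344a419; LINE g23-3
«history_resolved» minus its hypothesis rows; critic #461 P3 ∕ #465 «durable regardless of LFT∘»); SPLIT and LANDED by width seat `ym3-torus-px20` g12 (RULING №36: the
ideator files no Theorems) — theorem blocks BYTE-IDENTICAL to the ideator's; the generic additivity lemmas of its §1 are NOT restated but IMPORTED from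
✓`FluctuationComparisonRegPrIntLRestrictedDensityAdditivity` (p768123, the ideator's v2 file), and the definitions from ✓`…HistoryPartitionDefs`.

WHAT THIS FILE PROVES (bookkeeping, measure theory and real analysis over lit `resDensity` ∕ `heightDensity` ∕ `histGood` ∕ `θBal` ∕ `B10.pFun`; 0 sorry):
* §1 on the history partition: `heightDensity_eq_sum_histories_ae` (`hD univ = Σ_Q hD E_Q` a.e. — (41)'s «sum over histories», typed),
  `heightDensity_compl_histGood_ae` (`hD (histGood)ᶜ = Σ_Q hD E_Q − hD E_∅` a.e.);
* §2 the ENTROPY COUNT ★`historyCount` (LINE g23-3's row COUNT∘ — the ideator's `HistoryCountCan` text as the statement, no `def`) — for `0 < γ ≤ 1 ≤ b₀`, `1 ≤ p₀`, `0 < κ` and every `n` there is `W` with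
  `Π_{e : LFLabel F K n} (1 + smallFactor (K − j_e)) ≤ W` for ALL `K ≥ n` (lit `card_plaq_three` ∕ `Site.card_site`; sub-Gaussian-in-height small factor; geometric
  tail), with `sum_prod_smallFactor_eq` (`Σ_Q Π_{e∈Q} w_e = Π_e (1 + w_e)`);
* §3 the CUT-OFF-HEIGHT instance (`K = n`, no RG step) of LINE g23-3's row LFT∘ with `κ = ¼`, `C = Z_n⁻¹`: `heightDensity_self_eq`,
  `card_mul_sq_le_wilsonAction4_of_mem_histEvent` ((11) p.258 on `SU(2)` = lit `B10Eq71TorusLocal.dist1_sq_le_specialUnitaryGroup`), `β_mul_θBal_sq`, `θBal_nonneg`,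
  ★`largeFieldTerm_self`, `largeFieldTerm_at_cutoff` — a CONSISTENCY rung (dimensional check of the row's currency), NOT a piece of the 𝐑-operation.

HONEST: bookkeeping and elementary estimates only; nothing of Bałaban's renormalisation-group analysis ((5)∕(6), (38)–(47), the 𝐑-operation) is asserted or proved;
the per-history bound for `K > n` (LFT∘), the stability letters, crux 20520 and `YM3TorusSU2` are NOT proved here; rung R3 = SU(2) YM₃ on T³ — NOT d = 4, NOT
infinite volume, NOT a mass gap, NOT Clay.

References: [Balaban1985UV3] T. Bałaban, Commun. Math. Phys. 102 (1985) 255–275: (2) p.256, (7) p.257, (11) p.258, (41) p.266, (67)–(71) pp.273–274.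
-/

noncomputable section

set_option autoImplicit false

open MeasureTheory Filter Topology Set
open scoped ENNReal NNReal
open Literature.MathematicalPhysics.QuantumFieldTheory.Balaban1983to89
open Literature.MathematicalPhysics.QuantumFieldTheory.Balaban1983to89.T3ContinuumYM3Torus
open Literature.MathematicalPhysics.QuantumFieldTheory.Balaban1983to89.T3LevelShift
open Literature.MathematicalPhysics.QuantumFieldTheory.Balaban1983to89.T3NestedUnitLaws
open Literature.MathematicalPhysics.QuantumFieldTheory.Balaban1983to89.T3UnitLawDensityEML
open Literature.MathematicalPhysics.QuantumFieldTheory.Balaban1983to89.T3UnitScaleTilt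
open Literature.MathematicalPhysics.QuantumFieldTheory.Balaban1983to89.T3RestrictedUnitDensity
open Literature.MathematicalPhysics.QuantumFieldTheory.Balaban1983to89.T3TiltDescent
open Literature.MathematicalPhysics.QuantumFieldTheory.Balaban1983to89.T3CruxEstimates
open Literature.MathematicalPhysics.QuantumFieldTheory.Balaban1983to89.T3HeightwiseDensityBounds
open Literature.MathematicalPhysics.QuantumFieldTheory.Balaban1983to89.Missing

open Summit.QuantumFields.YangMills.Theorems.FluctuationComparisonRegPrIntLRestrictedDensityAdditivity

namespace Summit.QuantumFields.YangMills.Theorems.FluctuationComparisonRegPrIntLHistoryPartition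

/-! ## §1 The height density over the history partition (additivity ⟸ ✓`…RestrictedDensityAdditivity`) -/

section Additivity

variable {F : T3Family} {γ : ℝ} {K : ℕ}

/-- **THE SUM OVER HISTORIES** (41), typed: `heightDensity univ = Σ_Q heightDensity E_Q` a.e. at the comparison height.
[cite: Balaban1985UV3, (41) p.266] -/
theorem heightDensity_eq_sum_histories_ae {n : ℕ} (hK : n ≤ K) (θ : ℕ → ℝ) (hγ : 0 ≤ γ) :
    ∀ᵐ V ∂fieldMeasure (F.P n) 0 (Matrix.specialUnitaryGroup (Fin 2) ℂ),
      heightDensity F γ hK Set.univ V = ∑ Q : Finset (LFLabel F K n), heightDensity F γ hK (histEvent F θ K n Q) V := by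
  have h := heightDensity_biUnion_ae (F := F) (γ := γ) hK (Finset.univ : Finset (Finset (LFLabel F K n)))
    (fun Q => measurableSet_histEvent θ K n Q) (fun Q _ Q' _ hne => histEvent_disjoint hne) hγ
  rw [iUnion_histEvent_eq_univ θ K n] at h
  exact h

/-- **THE LARGE-HISTORY MASS IS THE SUM OVER NON-EMPTY HISTORIES**: `heightDensity (histGood)ᶜ = Σ_Q heightDensity E_Q − heightDensity E_∅` a.e.,
with `E_∅ = histGood`. [cite: Balaban1985UV3, (7) p.257 and (41) p.266] -/
theorem heightDensity_compl_histGood_ae {n : ℕ} (hK : n ≤ K) (θ : ℕ → ℝ) (hγ : 0 ≤ γ) :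
    ∀ᵐ V ∂fieldMeasure (F.P n) 0 (Matrix.specialUnitaryGroup (Fin 2) ℂ),
      heightDensity F γ hK (histGood F ℰp θ K n)ᶜ V =
        (∑ Q : Finset (LFLabel F K n), heightDensity F γ hK (histEvent F θ K n Q) V) - heightDensity F γ hK (histEvent F θ K n ∅) V := by
  have hsplit := resDensity_union_ae (F := F) (γ := γ) (K := K) (measurableSet_histGood F ℰp measurableE_ℰp θ K n)
    (measurableSet_histGood F ℰp measurableE_ℰp θ K n).compl disjoint_compl_right hγ (k := K - n) (by omega)
  rw [Set.union_compl_self] at hsplit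
  have hmp := measurePreserving_fieldShift (G := Matrix.specialUnitaryGroup (Fin 2) ℂ)
    (F.sitesPerDir_eq (m := F.m) (K := K) (j := K - n) (m' := F.m) (K' := n) (j' := 0) (by omega))
  filter_upwards [hmp.quasiMeasurePreserving.ae hsplit, heightDensity_eq_sum_histories_ae (F := F) (γ := γ) hK θ hγ] with V hV hsum
  rw [← histGood_eq_histEvent_empty θ hK]
  have hV' : heightDensity F γ hK Set.univ V = heightDensity F γ hK (histGood F ℰp θ K n) V + heightDensity F γ hK (histGood F ℰp θ K n)ᶜ V := hV
  linarith

end Additivity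

/-! ## §2b The ENTROPY COUNT, PROVED: small factors `e^{−κp(g_i)²}` beat the plaquette count `24·L^{3(m+i)}` of height `i` -/

section Entropy

/-- `αt − βt² ≤ α²∕(4β)` (`β > 0`). [folklore] -/
theorem lin_sub_quad_le {α β : ℝ} (hβ : 0 < β) (t : ℝ) : α * t - β * t ^ 2 ≤ α ^ 2 / (4 * β) := by
  have h : 0 ≤ β * (t - α / (2 * β)) ^ 2 := by positivity
  have h' : β * (t - α / (2 * β)) ^ 2 = β * t ^ 2 - α * t + α ^ 2 / (4 * β) := by
    field_simp
    ring
  linarith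

/-- THE SMALL FACTOR IS SUB-GAUSSIAN IN THE HEIGHT: `e^{−κp(g_i)²} ≤ e^{−κ(log L∕2)²·i²}` for `γ ≤ 1 ≤ b₀`, `1 ≤ p₀` (`log g_i⁻¹ ≥ i·log L∕2`,
`p(g) ≥ 1 + log g⁻¹`). [cite: Balaban1985UV3, (7) p.257] -/
theorem smallFactor_le_exp_neg_sq {L : ℕ} (hL : 1 < L) {γ b₀ p₀ κ : ℝ} (hγ : 0 < γ) (hγ1 : γ ≤ 1) (hb : 1 ≤ b₀)
    (hp : 1 ≤ p₀) (hκ : 0 ≤ κ) (i : ℕ) :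
    smallFactor L γ b₀ p₀ κ i ≤ Real.exp (-(κ * ((Real.log L / 2) ^ 2 * (i : ℝ) ^ 2))) := by
  unfold smallFactor
  apply Real.exp_le_exp.mpr
  have hL0 : (0 : ℝ) < L := by exact_mod_cast (zero_lt_one.trans hL)
  have hlogL : 0 ≤ Real.log L := Real.log_nonneg (by exact_mod_cast hL.le)
  have hin : 0 < γ * ((L : ℝ)⁻¹) ^ i := by positivity
  have hlog : Real.log L / 2 * i ≤ Real.log (Real.sqrt (γ * ((L : ℝ)⁻¹) ^ i))⁻¹ := by
    rw [Real.log_inv, Real.log_sqrt hin.le, Real.log_mul hγ.ne' (by positivity), Real.log_pow, Real.log_inv]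
    have : Real.log γ ≤ 0 := Real.log_nonpos hγ.le hγ1
    nlinarith
  have hc0 : 0 ≤ Real.log L / 2 * i := mul_nonneg (div_nonneg hlogL two_pos.le) (Nat.cast_nonneg i)
  have hx1 : 1 ≤ 1 + Real.log (Real.sqrt (γ * ((L : ℝ)⁻¹) ^ i))⁻¹ := by linarith
  have hp' : Real.log L / 2 * i ≤ B10.pFun b₀ p₀ (Real.sqrt (γ * ((L : ℝ)⁻¹) ^ i)) := by
    unfold B10.pFun
    set x := 1 + Real.log (Real.sqrt (γ * ((L : ℝ)⁻¹) ^ i))⁻¹ with hx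
    have hxp : x ≤ x ^ p₀ := by
      calc x = x ^ (1 : ℝ) := (Real.rpow_one x).symm
        _ ≤ x ^ p₀ := Real.rpow_le_rpow_of_exponent_le hx1 hp
    have hx0 : 0 ≤ x ^ p₀ := Real.rpow_nonneg (by linarith) _
    calc Real.log L / 2 * i ≤ x := by linarith
      _ ≤ x ^ p₀ := hxp
      _ = 1 * x ^ p₀ := (one_mul _).symm
      _ ≤ b₀ * x ^ p₀ := mul_le_mul_of_nonneg_right hb hx0
  have hsq : (Real.log L / 2) ^ 2 * (i : ℝ) ^ 2 ≤ (B10.pFun b₀ p₀ (Real.sqrt (γ * ((L : ℝ)⁻¹) ^ i))) ^ 2 := by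
    rw [← mul_pow]; exact pow_le_pow_left₀ hc0 hp' 2
  nlinarith [hsq, hκ]

/-- ONE HEIGHT: `L^{3i}·e^{−κp(g_i)²} ≤ e^{A}·e^{−i}` with `A := (3 log L + 1)²∕(4κ(log L∕2)²)` (complete the square). [folklore] -/
theorem pow_mul_smallFactor_le {L : ℕ} (hL : 1 < L) {γ b₀ p₀ κ : ℝ} (hγ : 0 < γ) (hγ1 : γ ≤ 1) (hb : 1 ≤ b₀)
    (hp : 1 ≤ p₀) (hκ : 0 < κ) (i : ℕ) :
    ((L : ℝ)) ^ (3 * i) * smallFactor L γ b₀ p₀ κ i ≤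
      Real.exp ((3 * Real.log L + 1) ^ 2 / (4 * (κ * (Real.log L / 2) ^ 2))) * Real.exp (-(i : ℝ)) := by
  have hL0 : (0 : ℝ) < L := by exact_mod_cast (zero_lt_one.trans hL)
  have hlogL : 0 < Real.log L := Real.log_pos (by exact_mod_cast hL)
  have hβ : 0 < κ * (Real.log L / 2) ^ 2 := by positivity
  have hLpow : ((L : ℝ)) ^ (3 * i) = Real.exp (((3 * i : ℕ) : ℝ) * Real.log L) := by
    rw [Real.exp_nat_mul, Real.exp_log hL0]
  rw [hLpow, ← Real.exp_add]
  calc Real.exp (((3 * i : ℕ) : ℝ) * Real.log L) * smallFactor L γ b₀ p₀ κ i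
      ≤ Real.exp (((3 * i : ℕ) : ℝ) * Real.log L) * Real.exp (-(κ * ((Real.log L / 2) ^ 2 * (i : ℝ) ^ 2))) :=
        mul_le_mul_of_nonneg_left (smallFactor_le_exp_neg_sq hL hγ hγ1 hb hp hκ.le i) (Real.exp_pos _).le
    _ = Real.exp ((3 * Real.log L) * i - (κ * (Real.log L / 2) ^ 2) * (i : ℝ) ^ 2) := by
        rw [← Real.exp_add]; push_cast; ring_nf
    _ ≤ Real.exp ((3 * Real.log L + 1) ^ 2 / (4 * (κ * (Real.log L / 2) ^ 2)) + -(i : ℝ)) := by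
        apply Real.exp_le_exp.mpr
        have := lin_sub_quad_le (α := 3 * Real.log L + 1) hβ (i : ℝ)
        linarith

/-- THE GEOMETRIC TAIL over the constrained levels: `Σ_{j ≤ K−n} e^{−(K−j)} ≤ (1 − e^{−1})⁻¹`. [folklore] -/
theorem sum_exp_neg_le (K N : ℕ) (hN : N ≤ K + 1) :
    ∑ j : Fin N, Real.exp (-((K - j.val : ℕ) : ℝ)) ≤ (1 - Real.exp (-1))⁻¹ := by
  have hr0 : 0 ≤ Real.exp (-1) := (Real.exp_pos _).le
  have hr1 : Real.exp (-1) < 1 := by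
    rw [← Real.exp_zero]
    exact Real.exp_lt_exp.mpr (by norm_num)
  have hterm : ∀ m : ℕ, Real.exp (-((m : ℕ) : ℝ)) = Real.exp (-1) ^ m := fun m => by
    rw [← Real.exp_nat_mul]; ring_nf
  simp_rw [hterm]
  rw [Fin.sum_univ_eq_sum_range (fun j => Real.exp (-1) ^ (K - j)) N]
  have hinj : Set.InjOn (fun j => K - j) ↑(Finset.range N) := by
    intro a ha b hb hab
    simp only [Finset.coe_range, Set.mem_Iio] at ha hb
    simp only at hab
    omega
  rw [← Finset.sum_image hinj]
  calc ∑ x ∈ (Finset.range N).image (fun j => K - j), Real.exp (-1) ^ x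
      ≤ ∑' i : ℕ, Real.exp (-1) ^ i :=
        (summable_geometric_of_lt_one hr0 hr1).sum_le_tsum _ (fun i _ => pow_nonneg hr0 i)
    _ = (1 - Real.exp (-1))⁻¹ := tsum_geometric_of_lt_one hr0 hr1

/-- ★ **COUNT∘ PROVED**: `Π_{(j,p)} (1 + e^{−κp(g_{K−j})²}) ≤ exp(24·L^{3m}·e^{A}·(1 − e^{−1})⁻¹)` for every run `K ≥ n` — the product over
the Σ-type is `Π_j (1 + w_{K−j})^{#Plaq(T^{(j)})}` (`Fintype.prod_sigma`), `#Plaq(T^{(j)}) = 3·(2L^{m+K−j})³` (lit `B10Eq41TorusHistories.card_plaq_three`,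
`Site.card_site`), `1 + w ≤ e^{w}`, one height's bound `pow_mul_smallFactor_le` and the geometric tail.  Elementary; NOT Bałaban's.
[cite: Balaban1985UV3, p.256 and (41) p.266] -/
theorem historyCount :
    ∀ (F : T3Family) (γ b₀ p₀ κ : ℝ), 0 < γ → γ ≤ 1 → 1 ≤ b₀ → 1 ≤ p₀ → 0 < κ →
      ∀ (n : ℕ), ∃ W : ℝ, ∀ (K : ℕ), n ≤ K →
        (∏ e : LFLabel F K n, (1 + smallFactor F.L γ b₀ p₀ κ (K - e.1.val))) ≤ W := by
  intro F γ b₀ p₀ κ hγ hγ1 hb hp hκ n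
  refine ⟨Real.exp (24 * (F.L : ℝ) ^ (3 * F.m) *
      Real.exp ((3 * Real.log F.L + 1) ^ 2 / (4 * (κ * (Real.log F.L / 2) ^ 2))) * (1 - Real.exp (-1))⁻¹), fun K hK => ?_⟩
  have hL : 1 < F.L := F.hL.2
  have hL0 : (0 : ℝ) < F.L := by exact_mod_cast zero_lt_one.trans hL
  set A := (3 * Real.log F.L + 1) ^ 2 / (4 * (κ * (Real.log F.L / 2) ^ 2)) with hA
  have hprod : (∏ e : LFLabel F K n, (1 + smallFactor F.L γ b₀ p₀ κ (K - e.1.val))) =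
      ∏ j : Fin (K - n + 1), (1 + smallFactor F.L γ b₀ p₀ κ (K - j.val)) ^ Fintype.card (Plaq (F.P K) j.val) := by
    rw [Fintype.prod_sigma]
    refine Finset.prod_congr rfl fun j _ => ?_
    simp only [Finset.prod_const, Finset.card_univ]
  rw [hprod]
  have hw0 : ∀ i, 0 ≤ smallFactor F.L γ b₀ p₀ κ i := fun i => (Real.exp_pos _).le
  have hfac : ∀ j : Fin (K - n + 1),
      (1 + smallFactor F.L γ b₀ p₀ κ (K - j.val)) ^ Fintype.card (Plaq (F.P K) j.val) ≤
        Real.exp ((Fintype.card (Plaq (F.P K) j.val) : ℝ) * smallFactor F.L γ b₀ p₀ κ (K - j.val)) := by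
    intro j
    rw [Real.exp_nat_mul]
    refine pow_le_pow_left₀ (by linarith [hw0 (K - j.val)]) ?_ _
    have := Real.add_one_le_exp (smallFactor F.L γ b₀ p₀ κ (K - j.val))
    linarith
  have hcard : ∀ j : Fin (K - n + 1),
      (Fintype.card (Plaq (F.P K) j.val) : ℝ) = 24 * (F.L : ℝ) ^ (3 * F.m) * (F.L : ℝ) ^ (3 * (K - j.val)) := by
    intro j
    rw [B10Eq41TorusHistories.card_plaq_three (F.P_d K) j.val, Site.card_site]
    have hs : (F.P K).sitesPerDir j.val = 2 * F.L ^ (F.m + K - j.val) := rfl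
    rw [hs, F.P_d]
    have hj : j.val ≤ K := by have := j.isLt; omega
    have hmk : F.m + K - j.val = F.m + (K - j.val) := by omega
    rw [hmk]
    push_cast
    ring
  have hterm : ∀ j : Fin (K - n + 1),
      (Fintype.card (Plaq (F.P K) j.val) : ℝ) * smallFactor F.L γ b₀ p₀ κ (K - j.val) ≤
        24 * (F.L : ℝ) ^ (3 * F.m) * (Real.exp A * Real.exp (-((K - j.val : ℕ) : ℝ))) := by
    intro j
    rw [hcard j, mul_assoc]
    exact mul_le_mul_of_nonneg_left (pow_mul_smallFactor_le hL hγ hγ1 hb hp hκ (K - j.val)) (by positivity)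
  calc ∏ j : Fin (K - n + 1), (1 + smallFactor F.L γ b₀ p₀ κ (K - j.val)) ^ Fintype.card (Plaq (F.P K) j.val)
      ≤ ∏ j : Fin (K - n + 1), Real.exp ((Fintype.card (Plaq (F.P K) j.val) : ℝ) * smallFactor F.L γ b₀ p₀ κ (K - j.val)) :=
        Finset.prod_le_prod (fun j _ => pow_nonneg (by linarith [hw0 (K - j.val)]) _) (fun j _ => hfac j)
    _ = Real.exp (∑ j : Fin (K - n + 1), (Fintype.card (Plaq (F.P K) j.val) : ℝ) * smallFactor F.L γ b₀ p₀ κ (K - j.val)) :=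
        (Real.exp_sum _ _).symm
    _ ≤ Real.exp (24 * (F.L : ℝ) ^ (3 * F.m) * Real.exp A * (1 - Real.exp (-1))⁻¹) := by
        apply Real.exp_le_exp.mpr
        calc ∑ j : Fin (K - n + 1), (Fintype.card (Plaq (F.P K) j.val) : ℝ) * smallFactor F.L γ b₀ p₀ κ (K - j.val)
            ≤ ∑ j : Fin (K - n + 1), 24 * (F.L : ℝ) ^ (3 * F.m) * (Real.exp A * Real.exp (-((K - j.val : ℕ) : ℝ))) :=
              Finset.sum_le_sum fun j _ => hterm j
          _ = 24 * (F.L : ℝ) ^ (3 * F.m) * Real.exp A * ∑ j : Fin (K - n + 1), Real.exp (-((K - j.val : ℕ) : ℝ)) := by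
              rw [Finset.mul_sum]
              refine Finset.sum_congr rfl fun j _ => ?_
              ring
          _ ≤ 24 * (F.L : ℝ) ^ (3 * F.m) * Real.exp A * (1 - Real.exp (-1))⁻¹ :=
              mul_le_mul_of_nonneg_left (sum_exp_neg_le K (K - n + 1) (by omega)) (by positivity)

end Entropy

/-- `Σ_Q Π_{e ∈ Q} w_e = Π_e (1 + w_e)` over ALL histories (Mathlib `Finset.prod_one_add`, `Finset.powerset_univ`). [folklore] -/
theorem sum_prod_smallFactor_eq {F : T3Family} {K n : ℕ} (w : LFLabel F K n → ℝ) :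
    ∑ Q : Finset (LFLabel F K n), ∏ e ∈ Q, w e = ∏ e : LFLabel F K n, (1 + w e) := by
  rw [Finset.prod_one_add, Finset.powerset_univ]

/-! ## §3 THE CUT-OFF-HEIGHT INSTANCE (PROVED, 0 sorry) of the per-history large-field bound (LINE g23-3's row LFT∘) AT `K = n`, with `κ = ¼` and `C = Z_n⁻¹`

At `K = n` no averaging has happened: `heightDensity F γ le_rfl E V = 1_E(V)·e^{−β_n A(V)}` (index bookkeeping over `n − n = 0`), every label
`e = (j, p)` has `j = 0`, and for `V ∈ E_Q` each plaquette `p` with `(0, p) ∈ Q` is `θ_n`-LARGE, so by (11) `‖U − 1‖² ≤ 2N(1 − Re tr U)` on `SU(2)`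
(tree `B10Eq71TorusLocal.dist1_sq_le_specialUnitaryGroup`) it costs Wilson action `≥ ¼θ_n²`, and `β_n·θ_n² = p(g_n)²` EXACTLY (`β_n = (γL^{−n})⁻¹`,
`θ_n = g_n·p(g_n)`, `g_n² = γL^{−n}`).  Hence `Z_n⁻¹·heightDensity(E_Q)(V) ≤ Z_n⁻¹·Π_{e ∈ Q} e^{−¼p(g_n)²}` for EVERY `V` (not only a.e.) — LFT∘'s inner
body at `K = n` with `κ = ¼` (print's (71) constant) and `C = Z_n⁻¹`.  This is a CONSISTENCY rung: it certifies that the row's currency (the DATUM-scale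
profile `θBal`, the small factor `e^{−κp(g_{K−j})²}` taken at the label's height, the normalisation `Z_K⁻¹`) is dimensionally the right one; it sits
inside the regime where everything is trivial (no RG step) and is NOT a witness of weakness and NOT a piece of Bałaban's 𝐑-operation. -/

section Rung

variable {F : T3Family}

/-- `heightDensity` at the cut-off height IS the restricted Boltzmann weight: `ρ^{S}_{n−n}(fieldShift V) = 1_S(V)·e^{−β_n A(V)}`.
[cite: Balaban1985UV3, (2) p.256 and (41) p.266] -/
theorem heightDensity_self_eq {γ : ℝ} {n : ℕ} (S : Set (GaugeField (F.P n) 0 (Matrix.specialUnitaryGroup (Fin 2) ℂ)))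
    (V : GaugeField (F.P n) 0 (Matrix.specialUnitaryGroup (Fin 2) ℂ)) :
    heightDensity F γ (le_refl n) S V = S.indicator (boltzmann (F.P n) ((F.scheme ℰp γ).β n)) V := by
  have aux : ∀ (j : ℕ) (hj : j = 0) (e : (F.PP F.m n).sitesPerDir j = (F.PP F.m n).sitesPerDir 0),
      resDensity F γ n S j (fieldShift e V) = S.indicator (boltzmann (F.P n) ((F.scheme ℰp γ).β n)) V := by
    intro j hj e
    subst hj
    rw [fieldShift_refl]
    rfl
  exact aux (n - n) (Nat.sub_self n) _

/-- THE ACTION COST OF A HISTORY AT THE CUT-OFF HEIGHT: for `V ∈ E_Q` (all pairs of `Q` large, threshold `θ_n ≥ 0`),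
`|Q|·θ_n²/4 ≤ A(V)` — each large plaquette costs `1 − Re tr V(∂p) ≥ ¼‖V(∂p) − 1‖² ≥ ¼θ_n²` by (11). [cite: Balaban1985UV3, (11) p.258 and (7) p.257] -/
theorem card_mul_sq_le_wilsonAction4_of_mem_histEvent {θ : ℕ → ℝ} {n : ℕ} (hθ : 0 ≤ θ n) {Q : Finset (LFLabel F n n)}
    {V : GaugeField (F.P n) 0 (Matrix.specialUnitaryGroup (Fin 2) ℂ)} (hV : V ∈ histEvent F θ n n Q) :
    (Q.card : ℝ) * (θ n ^ 2 / 4) ≤ wilsonAction4 V := by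
  classical
  -- the finest-level plaquettes whose label is in `Q`
  set T : Finset (Plaq (F.P n) 0) := Finset.univ.filter (fun p => labelZero F n p ∈ Q) with hT
  have hQT : Q = T.image (labelZero F n) := by
    ext e
    simp only [hT, Finset.mem_image, Finset.mem_filter, Finset.mem_univ, true_and]
    constructor
    · intro he
      obtain ⟨p, rfl⟩ := labelZero_surjective n e
      exact ⟨p, he, rfl⟩
    · rintro ⟨p, hp, rfl⟩
      exact hp
  have hcard : Q.card = T.card := by
    rw [hQT, Finset.card_image_of_injective _ (labelZero_injective n)]
  -- each plaquette of `T` costs at least `θ_n²/4`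
  have hterm : ∀ p ∈ T, θ n ^ 2 / 4 ≤ 1 - GaugeGroup.reTr (GaugeField.plaqHol V p) := by
    intro p hp
    have hpQ : labelZero F n p ∈ Q := (Finset.mem_filter.mp hp).2
    have hl : IsLarge F θ n n V (labelZero F n p) := (hV (labelZero F n p)).mp hpQ
    have hl' : θ n ≤ GaugeGroup.dist1 (GaugeField.plaqHol V p) := by
      simpa [IsLarge, labelZero, Averaging.iter] using hl
    have h11 := B10Eq71TorusLocal.dist1_sq_le_specialUnitaryGroup (GaugeField.plaqHol V p)
    have hsq : θ n ^ 2 ≤ GaugeGroup.dist1 (GaugeField.plaqHol V p) ^ 2 := pow_le_pow_left₀ hθ hl' 2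
    push_cast at h11
    linarith
  have hsum : (T.card : ℝ) * (θ n ^ 2 / 4) ≤ ∑ p ∈ T, (1 - GaugeGroup.reTr (GaugeField.plaqHol V p)) := by
    have := Finset.card_nsmul_le_sum T (fun p => 1 - GaugeGroup.reTr (GaugeField.plaqHol V p)) (θ n ^ 2 / 4) hterm
    simpa [nsmul_eq_mul] using this
  have hsub : ∑ p ∈ T, (1 - GaugeGroup.reTr (GaugeField.plaqHol V p)) ≤ wilsonAction4 V := by
    have hle : ∑ p ∈ T, (1 - GaugeGroup.reTr (GaugeField.plaqHol V p)) ≤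
        ∑ p, (1 - GaugeGroup.reTr (GaugeField.plaqHol V p)) :=
      Finset.sum_le_univ_sum_of_nonneg fun p => sub_nonneg.mpr (GaugeGroup.reTr_le_one _)
    simpa [wilsonAction4, wilsonAction, one_mul] using hle
  rw [hcard]
  exact hsum.trans hsub

/-- `β_n·θ_n² = p(g_n)²`: the datum-scale threshold squared, in units of the inverse coupling of run `n`, IS the exponent profile.
[cite: Balaban1985UV3, (3) p.256 and (7) p.257] -/
theorem β_mul_θBal_sq (F : T3Family) {γ : ℝ} (hγ : 0 < γ) (b₀ p₀ : ℝ) (n : ℕ) :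
    (F.scheme ℰp γ).β n * θBal F.L γ b₀ p₀ n ^ 2 =
      B10.pFun b₀ p₀ (Real.sqrt (γ * ((F.L : ℝ)⁻¹) ^ n)) ^ 2 := by
  have hL : (0 : ℝ) < (F.L : ℝ) := by exact_mod_cast (lt_trans zero_lt_one F.hL.2)
  have hx : 0 < γ * ((F.L : ℝ)⁻¹) ^ n := mul_pos hγ (pow_pos (inv_pos.mpr hL) n)
  have hβ : (F.scheme ℰp γ).β n = (γ * ((F.L : ℝ)⁻¹) ^ n)⁻¹ := rfl
  rw [hβ, θBal, mul_pow, Real.sq_sqrt hx.le, ← mul_assoc, inv_mul_cancel₀ hx.ne', one_mul]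

/-- At the cut-off height the threshold is nonnegative once `0 < γ ≤ 1 < L` and `0 ≤ b₀` (`g_n ≤ 1`, so `p(g_n) ≥ 0`).
[cite: Balaban1985UV3, (7) p.257] -/
theorem θBal_nonneg (F : T3Family) {γ b₀ : ℝ} (hγ : 0 < γ) (hγ1 : γ ≤ 1) (hb : 0 ≤ b₀) (p₀ : ℝ) (n : ℕ) :
    0 ≤ θBal F.L γ b₀ p₀ n := by
  have hL1 : (1 : ℝ) < (F.L : ℝ) := by exact_mod_cast F.hL.2
  have hL : (0 : ℝ) < (F.L : ℝ) := lt_trans zero_lt_one hL1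
  have hx : 0 < γ * ((F.L : ℝ)⁻¹) ^ n := mul_pos hγ (pow_pos (inv_pos.mpr hL) n)
  have hx1 : γ * ((F.L : ℝ)⁻¹) ^ n ≤ 1 :=
    mul_le_one₀ hγ1 (pow_nonneg (inv_pos.mpr hL).le n) (pow_le_one₀ (inv_pos.mpr hL).le (inv_le_one_of_one_le₀ hL1.le))
  have hg : 0 < Real.sqrt (γ * ((F.L : ℝ)⁻¹) ^ n) := Real.sqrt_pos.mpr hx
  have hg1 : Real.sqrt (γ * ((F.L : ℝ)⁻¹) ^ n) ≤ 1 := Real.sqrt_le_one.mpr hx1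
  exact mul_nonneg hg.le (B10.pFun_nonneg b₀ p₀ _ hb hg hg1)

/-- **RUNG — LFT∘ AT THE CUT-OFF HEIGHT, POINTWISE**: for every run `n`, every discrete history `Q` of run `n` below height `n` and EVERY fine field
`V`, `Z_n⁻¹·heightDensity(E_Q)(V) ≤ Z_n⁻¹ · Π_{e ∈ Q} e^{−¼·p(g_n)²}` (the product's factor at label `e = (j, p)` is taken at height `n − j = n`).
PROVED (0 sorry); a consistency rung inside the trivial regime `K = n`, NOT a piece of the 𝐑-operation. [cite: Balaban1985UV3, (11) p.258, (7) p.257 and (71) p.274] -/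
theorem largeFieldTerm_self (F : T3Family) {γ b₀ : ℝ} (p₀ : ℝ) (hγ : 0 < γ) (hγ1 : γ ≤ 1) (hb : 0 ≤ b₀) (n : ℕ)
    (Q : Finset (LFLabel F n n)) (V : GaugeField (F.P n) 0 (Matrix.specialUnitaryGroup (Fin 2) ℂ)) :
    (partitionFn (G := Matrix.specialUnitaryGroup (Fin 2) ℂ) (F.P n) ((F.scheme ℰp γ).β n))⁻¹ *
        heightDensity F γ (le_refl n) (histEvent F (θBal F.L γ b₀ p₀) n n Q) V ≤
      (partitionFn (G := Matrix.specialUnitaryGroup (Fin 2) ℂ) (F.P n) ((F.scheme ℰp γ).β n))⁻¹ *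
        ∏ e ∈ Q, smallFactor F.L γ b₀ p₀ (1 / 4) (n - e.1.val) := by
  have hZ : 0 ≤ (partitionFn (G := Matrix.specialUnitaryGroup (Fin 2) ℂ) (F.P n) ((F.scheme ℰp γ).β n))⁻¹ :=
    inv_nonneg.mpr (partitionFn_pos' _ (F.scheme_β_nonneg ℰp hγ.le n)).le
  refine mul_le_mul_of_nonneg_left ?_ hZ
  -- the product is the `|Q|`-th power of the height-`n` factor
  have hprod : ∏ e ∈ Q, smallFactor F.L γ b₀ p₀ (1 / 4) (n - e.1.val) = smallFactor F.L γ b₀ p₀ (1 / 4) n ^ Q.card := by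
    rw [← Finset.prod_const]
    refine Finset.prod_congr rfl fun e _ => ?_
    rw [LFLabel.level_eq_zero e, Nat.sub_zero]
  rw [hprod, heightDensity_self_eq]
  by_cases hV : V ∈ histEvent F (θBal F.L γ b₀ p₀) n n Q
  · rw [Set.indicator_of_mem hV, boltzmann, smallFactor, ← Real.exp_nat_mul]
    apply Real.exp_le_exp.mpr
    have hA := card_mul_sq_le_wilsonAction4_of_mem_histEvent (θ := θBal F.L γ b₀ p₀) (θBal_nonneg F hγ hγ1 hb p₀ n) hV
    have hβ0 : 0 ≤ (F.scheme ℰp γ).β n := F.scheme_β_nonneg ℰp hγ.le n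
    have hkey := β_mul_θBal_sq F hγ b₀ p₀ n
    -- `−β A ≤ −β·|Q|θ²/4 = −|Q|·p²/4`
    have h1 : (F.scheme ℰp γ).β n * ((Q.card : ℝ) * (θBal F.L γ b₀ p₀ n ^ 2 / 4)) ≤ (F.scheme ℰp γ).β n * wilsonAction4 V :=
      mul_le_mul_of_nonneg_left hA hβ0
    have h2 : (F.scheme ℰp γ).β n * ((Q.card : ℝ) * (θBal F.L γ b₀ p₀ n ^ 2 / 4)) =
        (Q.card : ℝ) * ((1 / 4) * B10.pFun b₀ p₀ (Real.sqrt (γ * ((F.L : ℝ)⁻¹) ^ n)) ^ 2) := by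
      rw [← hkey]; ring
    rw [h2] at h1
    linarith
  · rw [Set.indicator_of_notMem hV]
    exact pow_nonneg (smallFactor_pos _ _ _ _ _ _).le _

/-- **RUNG, IN LFT∘'s OWN SHAPE AT `K = n`**: `∃ C κ, 0 < κ ∧ ∀ Q, a.e. V, Z_n⁻¹·heightDensity(E_Q) ≤ C·Π_{e∈Q} smallFactor κ (n − j_e)` with
`κ = ¼`, `C = Z_n⁻¹` — the `K = n` instance of the stub's inner body, for every `0 < γ ≤ 1`, `0 ≤ b₀`, every `p₀`. PROVED (0 sorry).
[cite: Balaban1985UV3, (11) p.258, (7) p.257 and (71) p.274] -/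
theorem largeFieldTerm_at_cutoff (F : T3Family) {γ b₀ : ℝ} (p₀ : ℝ) (hγ : 0 < γ) (hγ1 : γ ≤ 1) (hb : 0 ≤ b₀) (n : ℕ) :
    ∃ C κ : ℝ, 0 < κ ∧ ∀ (Q : Finset (LFLabel F n n)),
      ∀ᵐ V ∂(fieldMeasure (F.P n) 0 (Matrix.specialUnitaryGroup (Fin 2) ℂ)),
        (partitionFn (G := Matrix.specialUnitaryGroup (Fin 2) ℂ) (F.P n) ((F.scheme ℰp γ).β n))⁻¹ *
            heightDensity F γ (le_refl n) (histEvent F (θBal F.L γ b₀ p₀) n n Q) V ≤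
          C * ∏ e ∈ Q, smallFactor F.L γ b₀ p₀ κ (n - e.1.val) :=
  ⟨_, 1 / 4, by norm_num, fun Q => Eventually.of_forall fun V => largeFieldTerm_self F p₀ hγ hγ1 hb n Q V⟩

end Rung

end Summit.QuantumFields.YangMills.Theorems.FluctuationComparisonRegPrIntLHistoryPartition

end
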